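import Literature.Topology.FourManifolds.TautFoliationsConePunctures
import Literature.Topology.FourManifolds.TautFoliationsFences
import HarnessLib

/-!
# The height of a fence in a flow box is, locally, a homeomorphism germ of the level

Sibling of `TautFoliationsFences.lean`. Near a point `(a₀, τ₁)` of the parameter domain of a
fence `Φ` over the unit interval, the height of `Φ a τ` in any flow box `e` of the atlas
containing `Φ a₀ τ₁` is `χ(τ)` for a homeomorphism germ `χ` at `τ₁` **independent of `a`**:
in the local datum `D` of the fence the height is `ψ_D(τ)`, and the `e`-height is the transition
germ from `D.box` to `e` applied to it (`Foliation.eventually_height_eq_transition`). This is the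
transversal structure of the fence used to read the coned fence collar in the boxes of a cone
position.

* `IsHomeoGermAt.of_continuousOn_injOn` (**proved**): a function continuous and injective on an
  open interval is a homeomorphism germ at its points.
* `IsFenceOn.exists_height_germ` (**proved**).

All statements are [folklore].
-/

noncomputable section

open Set Filter Function
open scoped Topology unitInterval

namespace Literature.Topology.FourManifolds

namespace Foliation

/-- A function continuous and injective on an open interval around `t` is a homeomorphism germ
at `t`. [folklore] -/
theorem IsHomeoGermAt.of_continuousOn_injOn {ψ : ℝ → ℝ} {a b t : ℝ} (ht : t ∈ Ioo a b) (hc : ContinuousOn ψ (Ioo a b))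
    (hi : InjOn ψ (Ioo a b)) : IsHomeoGermAt ψ t := by
  set δ := min (t - a) (b - t) / 2 with hδ
  have hδpos : 0 < δ := by have := lt_min (sub_pos.2 ht.1) (sub_pos.2 ht.2); positivity
  have hsubI : Icc (t - δ) (t + δ) ⊆ Ioo a b := by
    intro s hs
    have h1 := min_le_left (t - a) (b - t); have h2 := min_le_right (t - a) (b - t)
    constructor <;> linarith [hs.1, hs.2]
  have hsub : Ioo (t - δ) (t + δ) ⊆ Ioo a b := Ioo_subset_Icc_self.trans hsubI
  refine ⟨δ, hδpos, hc.mono hsub, ?_⟩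
  rcases (hc.mono hsubI).strictMonoOn_of_injOn_Icc' (by linarith) (hi.mono hsubI) with h | h
  · exact Or.inl (h.mono Ioo_subset_Icc_self)
  · exact Or.inr (h.mono Ioo_subset_Icc_self)

variable {B : Type*} [NormedAddCommGroup B] {M : Type*} [TopologicalSpace M] {F : Foliation B M}
variable {Γ : C(I, F.GermSpace)} {τ₀ ε : ℝ} {Φ : I → ℝ → M}

/-- **The height of a fence in a flow box is locally a homeomorphism germ of the level,
independent of the parameter.** [folklore] -/
theorem IsFenceOn.exists_height_germ (hΦ : IsFenceOn F Γ τ₀ ε Φ univ) {e : OpenPartialHomeomorph M (B × ℝ)} (he : e ∈ F.atlas)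
    {a₀ : I} {τ₁ : ℝ} (hτ₁ : τ₁ ∈ Ioo (τ₀ - ε) (τ₀ + ε)) (hsrc : Φ a₀ τ₁ ∈ e.source) :
    ∃ χ : ℝ → ℝ, IsHomeoGermAt χ τ₁ ∧ ∀ᶠ p : I × ℝ in 𝓝 (a₀, τ₁), height e (Φ p.1 p.2) = χ p.2 := by
  -- the local datum of the fence at `a₀`
  obtain ⟨U, hU, D, hD⟩ := hΦ.local_level a₀ (mem_univ a₀)
  have ha₀U : a₀ ∈ U ∩ univ := ⟨mem_of_mem_nhds hU, mem_univ _⟩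
  have hzD : Φ a₀ τ₁ ∈ D.box.source := (hD a₀ ha₀U τ₁ hτ₁).1
  have hzh : height D.box (Φ a₀ τ₁) = D.ψ τ₁ := (hD a₀ ha₀U τ₁ hτ₁).2
  -- the transition germ from `D.box` to `e` at the point
  set T := transition D.box e (Φ a₀ τ₁) with hT
  have hTgerm : IsHomeoGermAt T (D.ψ τ₁) := by
    have h := F.isHomeoGermAt_transition D.box_mem he hzD hsrc
    rwa [show (D.box (Φ a₀ τ₁)).2 = D.ψ τ₁ from hzh] at h
  have hψgerm : IsHomeoGermAt D.ψ τ₁ := IsHomeoGermAt.of_continuousOn_injOn hτ₁ D.ψ_cont D.ψ_inj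
  refine ⟨T ∘ D.ψ, hTgerm.comp hψgerm, ?_⟩
  -- near `(a₀, τ₁)`: the point is near `Φ a₀ τ₁`, the parameter in `U`, the level admissible
  have hev := F.eventually_height_eq_transition D.box_mem he hzD hsrc
  have hc : ContinuousAt (uncurry Φ) (a₀, τ₁) := hΦ.continuousAt isOpen_univ (mem_univ a₀) hτ₁
  have h1 : ∀ᶠ p : I × ℝ in 𝓝 (a₀, τ₁), height e (Φ p.1 p.2) = T (height D.box (Φ p.1 p.2)) := hc.eventually hev
  have h2 : ∀ᶠ p : I × ℝ in 𝓝 (a₀, τ₁), p.1 ∈ U := continuousAt_fst.preimage_mem_nhds hU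
  have h3 : ∀ᶠ p : I × ℝ in 𝓝 (a₀, τ₁), p.2 ∈ Ioo (τ₀ - ε) (τ₀ + ε) :=
    continuousAt_snd.preimage_mem_nhds (isOpen_Ioo.mem_nhds hτ₁)
  filter_upwards [h1, h2, h3] with p hp hpU hpτ
  rw [hp, comp_apply, (hD p.1 ⟨hpU, mem_univ _⟩ p.2 hpτ).2]

end Foliation

end Literature.Topology.FourManifolds
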